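import Literature.AlgebraicGeometry.Resolution.WeightedCentreLevelProjection
import Literature.AlgebraicGeometry.Resolution.WeightedCentreTailedLightFlow
import Literature.AlgebraicGeometry.Resolution.WeightedCentreEigenLiftLevels
import HarnessLib

/-!
# The `Z`-kernel `𝒢` of the toy model: set-up of THEOREM B, its case `r = p`, and the flow ↦ tailed-flow bridges
# (engine 1's `W(f)` toy model, target T107 part 1 — an instrument, NOT a resolution theorem)

THEOREM B of the cell's light-class chain (LF-MODEL-eng1-g45 §6.3, RE-DERIVATION-eng1-g44 §3.5; typed assembly T107 of
CARVER-NOTES-eng1-g45 §3) says: for a (P)-menu `N` of the setting with a bottom light class `Z`, the group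
`𝒢(N) = {X ∈ Iso(N, g) : X(ε_x) ≡ ε_x mod (ε_Z) for every slot}` of `Z`-INFINITESIMAL graded isotropies is trivial.  Its proof picks the
deepest level `r` of `H = ⟨s_μ X⟩ ≤ 𝒢` (`WeightedCentreEigenLift.exists_deepest_level`) and produces in each of the cases `r = p`,
`2 ≤ r ≤ p − 1`, `r = 1` a TAILED LIGHT FLOW on `(N, g)`, contradicting THEOREM 𝔉′ (`TailedLightFlow.noTailedLightFlow`,
`WeightedCentreDerivedFlow`).  This file types, on `S = k[ε][σ] = (MvPolynomial ι k)[X]` and hypothesis-free unless stated: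

* the ideal `slotIdeal Z = (ε_Z)·S` and the SUBGROUP `zKernel Z` of automorphisms `A` fixing `ε_Z` with `A y − y ∈ (ε_Z)` for all `y`
  (`mem_zKernel_of_slots`: checked on the slots for `k[σ]`-automorphisms), the subgroup `fixSlots V` (`A = id` on `ε_V`), and their
  stability under the torus `s_u` (`scaleConj_mem_zKernel`, `scaleConj_mem_fixSlots`, `scaleConj_mem_stabilizer`) — so that
  `𝒢 = graded ⊓ baseFixing ⊓ 𝔄_1 ⊓ zKernel Z ⊓ fixSlots V ⊓ Stab(C g)` is a `Q`-stable subgroup as THEOREM B's proof requires;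
* the SET-UP of LF-MODEL §6.3: every level datum `π_m(A)_i` of `A ∈ graded ⊓ zKernel Z` lies in `(ε_Z)` (`proj_mem_span`) and weighs `w i − m`
  (`isWeightedHomogeneous_proj`); a weighted-homogeneous element of the monomial ideal `(ε_Z)` of weight `< ζ = w(Z)` vanishes
  (`eq_zero_of_mem_span_of_lt`, non-negative weights), whence "all orders are `≤ w i − ζ`" (`proj_eq_zero_of_lt`), "𝒢 HAS NO PURE TERMS:
  `𝒢 ∩ 𝔄_{p+1} = {id}`" (`eq_one_of_mem_level`, `levelIn_eq_bot`), and the variables of a datum are light and lighter than the slot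
  (`le_of_mem_vars`, `vars_proj`) — the (tf1)/(tf3) shapes;
* `𝔇 := π_r(A)` READ AS A DERIVATION (`projDer r A`) with its triangular shape (`projDer_X`, `isWeightedHomogeneous_projDer`, `vars_projDer`,
  `projDer_X_of_mem`, `projDer_X_of_fix`) — the input of L3/W3 (`WeightedCentreWeightBoundedFlow`) in the case `2 ≤ r ≤ p − 1` and of L4 in the case `r = 1`;
* CASE `r = p` OF THEOREM B, complete (`apply_CX_eq_of_mem_level_p`, `false_of_mem_level_p`): a non-trivial `A ∈ 𝒢 ∩ 𝔄_p` moves every slot by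
  `σ^p · q_i`, `q_i = π_p(A)_i` a light form in `(ε_Z)` on heavy slots only, and `(0, q)` is a tailed light flow of unit `1` on `(N, g)`
  (`TailedLightFlow.IsTailedLightFlow p u w 1 g 0 q` with `T := σ`) — so `NoTailedLightFlow p u w g` is contradicted;
* the terminal BRIDGES of the other two cases: `false_of_expand_sigmaExp` (`g(Φ_𝔇(σ^r)ε) = g`, `r ≥ 1`, `𝔇 ≠ 0` triangular ⇒ `(𝔇, 0)` is a tailed
  light flow of unit `r`, `T := σ^r` free by `Polynomial.expand_injective`) and `false_of_apply_eq_substC` (`A = Φ(σ)` on `k[ε]` and `A` fixes `g`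
  ⇒ `(𝔇, q)` is a tailed light flow; case `r = 1`).

NOT typed here (the remaining assembly of T107, recorded for the next carver): the run of L3/W3 + L8 (`EigenLift.eigen_climb`) in the case
`2 ≤ r ≤ p − 1` and of L4 (`TruncatedFlow`) + `LevelReduction` + L8 + `FlowExtraction.eq_subst` in the case `r = 1`, and the final
`𝒢(N) = {id}` statement.  Hypothesis-honest: no hypothesis (P) appears — THEOREM 𝔉′ enters only as the hypothesis `NoTailedLightFlow p u w g`
of the two `false_of_…` theorems (it is a theorem of `WeightedCentreDerivedFlow` under slot pinning); the weights enter as the explicit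
hypotheses `0 ≤ w`, `ζ ≤ w z` on `Z`, `0 < ζ`.  Framing: instruments for engine 1's `W(f)` toy model (cell `pub-rosobs`, carver lane gen 66;
AI-written Lean, AI review weaker than expert review) — NOT statements about the invariant of [AbramovichTemkinWlodarczyk2024], NOT resolution
theorems.  The algebra is textbook: substitution endomorphisms and ideals of polynomial rings [Lang2002, Ch. II §1, Ch. IV §1], derivations /
truncated exponentials [Matsumura1987, §25, §27 (pp. 207–209)], gradings as in [AbramovichTemkinWlodarczyk2024, §5.1 (p. 1575), Thm. 5.3.1
(2)–(3) (p. 1578)]; formalisation and statements ours.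
-/

namespace Literature.AlgebraicGeometry.Resolution.WeightedBlowup.ZKernel

open Polynomial OrderFiltration LevelProjection EigenLiftLevels

variable {k : Type*} [CommRing k] {ι : Type*}

/-! ## The ideal `(ε_Z)` of `k[ε][σ]` -/

/-- The ideal `(ε_Z)·k[ε][σ]` generated by the bottom slots (construction; LF-MODEL-eng1-g45 (S4) "`𝒢`"). [cite: Lang2002, Ch. II §1] -/
noncomputable def slotIdeal (Z : Set ι) : Ideal (MvPolynomial ι k)[X] :=
  (Ideal.span (MvPolynomial.X '' Z) : Ideal (MvPolynomial ι k)).map (C : MvPolynomial ι k →+* (MvPolynomial ι k)[X])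

/-- Membership in `(ε_Z)·k[ε][σ]` is checked on the `σ`-coefficients (bookkeeping; `Ideal.mem_map_C_iff`). [cite: Lang2002, Ch. IV §1] -/
theorem mem_slotIdeal_iff {Z : Set ι} {y : (MvPolynomial ι k)[X]} :
    y ∈ slotIdeal Z ↔ ∀ n, y.coeff n ∈ (Ideal.span (MvPolynomial.X '' Z) : Ideal (MvPolynomial ι k)) :=
  Ideal.mem_map_C_iff

/-- `(ε_Z)·k[ε][σ]` is the span of the slots `C (X z)`, `z ∈ Z` (bookkeeping). [cite: Lang2002, Ch. II §1] -/
theorem slotIdeal_eq_span (Z : Set ι) :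
    (slotIdeal Z : Ideal (MvPolynomial ι k)[X]) = Ideal.span ((fun z => C (MvPolynomial.X z)) '' Z) := by
  rw [slotIdeal, Ideal.map_span, Set.image_image]

/-- The slots of `Z` lie in `(ε_Z)` (bookkeeping). [cite: Lang2002, Ch. II §1] -/
theorem C_X_mem_slotIdeal {Z : Set ι} {z : ι} (hz : z ∈ Z) : C (MvPolynomial.X z) ∈ (slotIdeal Z : Ideal (MvPolynomial ι k)[X]) := by
  rw [slotIdeal_eq_span]
  exact Ideal.subset_span ⟨z, hz, rfl⟩

/-- A ring endomorphism fixing the slots of `Z` maps `(ε_Z)` into itself (bookkeeping). [cite: Lang2002, Ch. II §1] -/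
theorem map_mem_slotIdeal {Z : Set ι} {F : Type*} [FunLike F (MvPolynomial ι k)[X] (MvPolynomial ι k)[X]]
    [RingHomClass F (MvPolynomial ι k)[X] (MvPolynomial ι k)[X]] {A : F}
    (hA : ∀ z ∈ Z, A (C (MvPolynomial.X z)) = C (MvPolynomial.X z)) {y : (MvPolynomial ι k)[X]} (hy : y ∈ slotIdeal Z) :
    A y ∈ slotIdeal Z := by
  have hle : (slotIdeal Z : Ideal (MvPolynomial ι k)[X]) ≤ (slotIdeal Z).comap A := by
    rw [slotIdeal_eq_span]
    refine Ideal.span_le.mpr ?_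
    rintro _ ⟨z, hz, rfl⟩
    rw [SetLike.mem_coe, Ideal.mem_comap, hA z hz]
    exact Ideal.subset_span ⟨z, hz, rfl⟩
  exact hle hy

/-! ## The `Z`-kernel subgroup and the slot-fixing subgroup -/

/-- **The `Z`-KERNEL**: ring automorphisms `A` of `k[ε][σ]` fixing `ε_Z` with `A y ≡ y (mod (ε_Z))` for every `y` — a subgroup
(LF-MODEL-eng1-g45 (S4)/§6.3: "`𝒢` is a group"; instrument for engine 1's `W(f)` toy model, NOT a resolution theorem). [cite: Lang2002, Ch. I §3, Ch. II §1] -/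
def zKernel (Z : Set ι) : Subgroup ((MvPolynomial ι k)[X] ≃+* (MvPolynomial ι k)[X]) where
  carrier := {A | (∀ z ∈ Z, A (C (MvPolynomial.X z)) = C (MvPolynomial.X z)) ∧ ∀ y, A y - y ∈ slotIdeal Z}
  mul_mem' := by
    rintro A B ⟨hAz, hA⟩ ⟨hBz, hB⟩
    refine ⟨fun z hz => by rw [RingAut.mul_apply, hBz z hz, hAz z hz], fun y => ?_⟩
    rw [RingAut.mul_apply, show A (B y) - y = A (B y - y) + (A y - y) by rw [map_sub]; ring]
    exact add_mem (map_mem_slotIdeal hAz (hB y)) (hA y)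
  one_mem' := ⟨fun _ _ => rfl, fun y => by rw [RingAut.one_apply, sub_self]; exact Ideal.zero_mem _⟩
  inv_mem' := by
    rintro A ⟨hAz, hA⟩
    refine ⟨fun z hz => by rw [RingAut.inv_apply, RingEquiv.symm_apply_eq, hAz z hz], fun y => ?_⟩
    have h := hA (A.symm y)
    rw [RingEquiv.apply_symm_apply] at h
    rw [RingAut.inv_apply, ← neg_sub]
    exact neg_mem h

/-- Membership in the `Z`-kernel (bookkeeping). [cite: Lang2002, Ch. II §1] -/
theorem mem_zKernel {Z : Set ι} {A : (MvPolynomial ι k)[X] ≃+* (MvPolynomial ι k)[X]} :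
    A ∈ zKernel Z ↔ (∀ z ∈ Z, A (C (MvPolynomial.X z)) = C (MvPolynomial.X z)) ∧ ∀ y, A y - y ∈ slotIdeal Z := Iff.rfl

/-- **`Z`-kernel membership is checked on the slots**: a `k[σ]`-automorphism fixing `ε_Z` with `A ε_i − ε_i ∈ (ε_Z)` for every slot lies in
`zKernel Z` (the defining property "`X(ε_x) ≡ ε_x mod (ε_Z)` for every slot" of LF-MODEL-eng1-g45 (S4); bookkeeping via the quotient by `(ε_Z)`). [cite: Lang2002, Ch. II §1, Ch. IV §1] -/
theorem mem_zKernel_of_slots {Z : Set ι} {A : (MvPolynomial ι k)[X] ≃+* (MvPolynomial ι k)[X]} (hAb : A ∈ baseFixing)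
    (hZ : ∀ z ∈ Z, A (C (MvPolynomial.X z)) = C (MvPolynomial.X z))
    (hgen : ∀ i, A (C (MvPolynomial.X i)) - C (MvPolynomial.X i) ∈ slotIdeal Z) : A ∈ zKernel Z := by
  refine ⟨hZ, fun y => ?_⟩
  let π : (MvPolynomial ι k)[X] →+* (MvPolynomial ι k)[X] ⧸ slotIdeal Z := Ideal.Quotient.mk (slotIdeal Z)
  have hC : (π.comp (A : (MvPolynomial ι k)[X] →+* (MvPolynomial ι k)[X])).comp C = π.comp C :=
    MvPolynomial.ringHom_ext
      (fun c => by rw [RingHom.comp_apply, RingHom.comp_apply, RingHom.comp_apply, RingEquiv.coe_toRingHom, hAb.2 c])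
      (fun i => by
        rw [RingHom.comp_apply, RingHom.comp_apply, RingHom.comp_apply, RingEquiv.coe_toRingHom]
        exact Ideal.Quotient.eq.mpr (hgen i))
  have hπ : π.comp (A : (MvPolynomial ι k)[X] →+* (MvPolynomial ι k)[X]) = π :=
    Polynomial.ringHom_ext (fun a => RingHom.congr_fun hC a)
      (by rw [RingHom.comp_apply, RingEquiv.coe_toRingHom, hAb.1])
  exact Ideal.Quotient.eq.mp (RingHom.congr_fun hπ y)

/-- **The torus preserves the `Z`-kernel**: `s_u (zKernel Z) ⊆ zKernel Z` — `σ ↦ uσ` fixes `k[ε]`, hence `(ε_Z)` (LF-MODEL-eng1-g45 §6.3: "`𝒢` is `Q`-stable";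
bookkeeping). [cite: SerreLocalFields1979, Ch. II §4 Lemma 1; Lang2002, Ch. I §3] -/
theorem scaleConj_mem_zKernel (u : kˣ) {Z : Set ι} {A : (MvPolynomial ι k)[X] ≃+* (MvPolynomial ι k)[X]} (hA : A ∈ zKernel Z) :
    scaleConj u A ∈ zKernel Z := by
  refine ⟨fun z hz => by rw [scaleConj_apply_C, hA.1 z hz, sigmaScale_C], fun y => ?_⟩
  have h := hA.2 ((scaleEquiv u).symm y)
  have hfix : ∀ z ∈ Z, scaleEquiv u (C (MvPolynomial.X z)) = C (MvPolynomial.X z) := fun z _ => scaleEquiv_C u _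
  have h' := map_mem_slotIdeal (A := scaleEquiv u) hfix h
  rwa [map_sub, RingEquiv.apply_symm_apply, ← scaleConj_apply_apply] at h'

/-- The automorphisms FIXING the slots of `V` pointwise — a subgroup (the XL normalisation "`X = id` on `ε_V`" of LF-MODEL-eng1-g45 (S4); bookkeeping).
[cite: Lang2002, Ch. I §3] -/
def fixSlots (V : Set ι) : Subgroup ((MvPolynomial ι k)[X] ≃+* (MvPolynomial ι k)[X]) where
  carrier := {A | ∀ v ∈ V, A (C (MvPolynomial.X v)) = C (MvPolynomial.X v)}
  mul_mem' hA hB := fun v hv => by rw [RingAut.mul_apply, hB v hv, hA v hv]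
  one_mem' := fun _ _ => rfl
  inv_mem' hA := fun v hv => by rw [RingAut.inv_apply, RingEquiv.symm_apply_eq, hA v hv]

/-- Membership in `fixSlots` (bookkeeping). [cite: Lang2002, Ch. I §3] -/
theorem mem_fixSlots {V : Set ι} {A : (MvPolynomial ι k)[X] ≃+* (MvPolynomial ι k)[X]} :
    A ∈ fixSlots V ↔ ∀ v ∈ V, A (C (MvPolynomial.X v)) = C (MvPolynomial.X v) := Iff.rfl

/-- The torus preserves `fixSlots V` (bookkeeping). [cite: SerreLocalFields1979, Ch. II §4 Lemma 1] -/
theorem scaleConj_mem_fixSlots (u : kˣ) {V : Set ι} {A : (MvPolynomial ι k)[X] ≃+* (MvPolynomial ι k)[X]} (hA : A ∈ fixSlots V) :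
    scaleConj u A ∈ fixSlots V := fun v hv => by
  rw [scaleConj_apply_C, hA v hv, sigmaScale_C]

/-- **The torus preserves isotropy of a constant**: if `A` fixes `C g` (`g ∈ k[ε]`), so does `s_u A` (LF-MODEL-eng1-g45 §6.3: `Iso` is `Q`-stable; bookkeeping).
[cite: SerreLocalFields1979, Ch. II §4 Lemma 1; Lang2002, Ch. I §5] -/
theorem scaleConj_mem_stabilizer (u : kˣ) {g : MvPolynomial ι k} {A : (MvPolynomial ι k)[X] ≃+* (MvPolynomial ι k)[X]}
    (hA : A ∈ MulAction.stabilizer ((MvPolynomial ι k)[X] ≃+* (MvPolynomial ι k)[X]) (C g : (MvPolynomial ι k)[X])) :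
    scaleConj u A ∈ MulAction.stabilizer ((MvPolynomial ι k)[X] ≃+* (MvPolynomial ι k)[X]) (C g : (MvPolynomial ι k)[X]) := by
  rw [MulAction.mem_stabilizer_iff, RingAut.smul_def] at hA ⊢
  rw [scaleConj_apply_C, hA, sigmaScale_C]

/-- A `k[σ]`-automorphism fixing every slot is the identity (bookkeeping). [cite: Lang2002, Ch. IV §1] -/
theorem eq_one_of_apply_CX {A : (MvPolynomial ι k)[X] ≃+* (MvPolynomial ι k)[X]} (hAb : A ∈ baseFixing)
    (h : ∀ i, A (C (MvPolynomial.X i)) = C (MvPolynomial.X i)) : A = 1 := by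
  have key : (A : (MvPolynomial ι k)[X] →+* (MvPolynomial ι k)[X]).comp C = C :=
    MvPolynomial.ringHom_ext (fun c => hAb.2 c) (fun i => h i)
  have hA1 : (A : (MvPolynomial ι k)[X] →+* (MvPolynomial ι k)[X]) = RingHom.id _ :=
    Polynomial.ringHom_ext (fun a => RingHom.congr_fun key a) hAb.1
  exact RingEquiv.ext fun y => RingHom.congr_fun hA1 y

/-! ## Weighted-homogeneous elements of the monomial ideal `(ε_Z)` -/

section Weights

variable {w : ι → ℚ} {Z : Set ι} {ζ : ℚ}

/-- A variable of a non-zero-free weighted-homogeneous polynomial weighs at most the polynomial (non-negative weights; bookkeeping).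
[cite: AbramovichTemkinWlodarczyk2024, §5.1 (p. 1575)] -/
theorem le_of_mem_vars (hw : ∀ i, 0 ≤ w i) {P : MvPolynomial ι k} {m : ℚ} (hPm : MvPolynomial.IsWeightedHomogeneous w P m)
    {j : ι} (hj : j ∈ P.vars) : w j ≤ m := by
  obtain ⟨d, hd, hjd⟩ := (MvPolynomial.mem_vars_iff_mem_support j).mp hj
  have hwt : Finsupp.weight w d = m := hPm (MvPolynomial.mem_support_iff.mp hd)
  rw [← hwt]
  exact Finsupp.le_weight_of_ne_zero hw (Finsupp.mem_support_iff.mp hjd)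

/-- In the monomial ideal `(ε_Z)` every monomial carries a `Z`-variable, so a variable OUTSIDE `Z` of a weighted-homogeneous element of weight `m`
weighs at most `m − ζ` when the slots of `Z` weigh `≥ ζ` (LF-MODEL-eng1-g45 §6.3 SET-UP: "a co-variable of the `Z`-factor weighs `≤ w − m − ζ`";
bookkeeping). [cite: AbramovichTemkinWlodarczyk2024, §5.1 (p. 1575); Lang2002, Ch. II §1] -/
theorem le_sub_of_mem_vars_of_not_mem (hw : ∀ i, 0 ≤ w i) (hZ : ∀ z ∈ Z, ζ ≤ w z) {P : MvPolynomial ι k} {m : ℚ}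
    (hP : P ∈ (Ideal.span (MvPolynomial.X '' Z) : Ideal (MvPolynomial ι k))) (hPm : MvPolynomial.IsWeightedHomogeneous w P m)
    {j : ι} (hj : j ∈ P.vars) (hjZ : j ∉ Z) : w j + ζ ≤ m := by
  classical
  obtain ⟨d, hd, hjd⟩ := (MvPolynomial.mem_vars_iff_mem_support j).mp hj
  have hwt : Finsupp.weight w d = m := hPm (MvPolynomial.mem_support_iff.mp hd)
  obtain ⟨z, hz, hdz⟩ := MvPolynomial.mem_ideal_span_X_image.mp hP d hd
  have hjz : j ≠ z := fun h => hjZ (h ▸ hz)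
  have hsub : ({j, z} : Finset ι) ⊆ d.support := by
    intro x hx
    rcases Finset.mem_insert.mp hx with rfl | hx
    · exact hjd
    · rw [Finset.mem_singleton] at hx
      exact Finsupp.mem_support_iff.mpr (hx ▸ hdz)
  have hle : ∑ x ∈ ({j, z} : Finset ι), d x • w x ≤ ∑ x ∈ d.support, d x • w x :=
    Finset.sum_le_sum_of_subset_of_nonneg hsub fun x _ _ => nsmul_nonneg (hw x) _
  rw [Finset.sum_pair hjz] at hle
  have h1 : w j ≤ d j • w j := by
    rw [nsmul_eq_mul]
    exact le_mul_of_one_le_left (hw j) (by exact_mod_cast Nat.one_le_iff_ne_zero.mpr (Finsupp.mem_support_iff.mp hjd))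
  have h2 : ζ ≤ d z • w z := by
    rw [nsmul_eq_mul]
    exact (hZ z hz).trans (le_mul_of_one_le_left (hw z) (by exact_mod_cast Nat.one_le_iff_ne_zero.mpr hdz))
  have hwd : Finsupp.weight w d = ∑ x ∈ d.support, d x • w x := Finsupp.weight_apply w d
  linarith

/-- **A weighted-homogeneous element of `(ε_Z)` of weight `< ζ` vanishes** (non-negative weights, `Z`-slots of weight `≥ ζ`): every monomial of it contains
a `Z`-variable and so weighs `≥ ζ` (LF-MODEL-eng1-g45 §6.3 SET-UP: "an order-`m` datum weighs `w_x − m ≥ ζ > 0`"; instrument, NOT a resolution theorem).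
[cite: AbramovichTemkinWlodarczyk2024, §5.1 (p. 1575); Lang2002, Ch. II §1] -/
theorem eq_zero_of_mem_span_of_lt (hw : ∀ i, 0 ≤ w i) (hZ : ∀ z ∈ Z, ζ ≤ w z) {P : MvPolynomial ι k} {m : ℚ}
    (hP : P ∈ (Ideal.span (MvPolynomial.X '' Z) : Ideal (MvPolynomial ι k))) (hPm : MvPolynomial.IsWeightedHomogeneous w P m)
    (hm : m < ζ) : P = 0 := by
  by_contra h0
  obtain ⟨d, hd⟩ := MvPolynomial.ne_zero_iff.mp h0
  have hwt : Finsupp.weight w d = m := hPm hd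
  obtain ⟨z, hz, hdz⟩ := MvPolynomial.mem_ideal_span_X_image.mp hP d (MvPolynomial.mem_support_iff.mpr hd)
  have h1 : w z ≤ Finsupp.weight w d := Finsupp.le_weight_of_ne_zero hw hdz
  linarith [hZ z hz]

end Weights

/-! ## SET-UP of THEOREM B: the data of a graded `Z`-infinitesimal automorphism -/

section SetUp

variable {w : ι → ℚ} {Z : Set ι} {ζ : ℚ} {A : (MvPolynomial ι k)[X] ≃+* (MvPolynomial ι k)[X]}

/-- Every level datum of `A ∈ zKernel Z` lies in the ideal `(ε_Z)` of `k[ε]` (LF-MODEL-eng1-g45 §6.3 SET-UP; bookkeeping). [cite: Lang2002, Ch. II §1, Ch. IV §1] -/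
theorem proj_mem_span (hAk : A ∈ zKernel Z) (m : ℕ) (i : ι) :
    proj m A i ∈ (Ideal.span (MvPolynomial.X '' Z) : Ideal (MvPolynomial ι k)) := by
  rw [proj_apply]
  exact mem_slotIdeal_iff.mp (hAk.2 _) m

/-- The order-`m` datum of a graded automorphism (`wt σ = 1`) on the slot `ε_i` weighs `w i − m` (LF-MODEL-eng1-g45 (S4); bookkeeping).
[cite: AbramovichTemkinWlodarczyk2024, Thm. 5.3.1 (2)–(3) (p. 1578)] -/
theorem isWeightedHomogeneous_proj (hAg : IsGradedHom w (1 : ℚ) (A : (MvPolynomial ι k)[X] →+* (MvPolynomial ι k)[X])) (m : ℕ) (i : ι) :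
    MvPolynomial.IsWeightedHomogeneous w (proj m A i) (w i - m) := by
  have hTW : IsTW w (1 : ℚ) (w i) (A (C (MvPolynomial.X i)) - C (MvPolynomial.X i)) := by
    rw [sub_eq_add_neg]
    exact (hAg.isTW_CX i).add (isTW_C (MvPolynomial.isWeightedHomogeneous_X k w i)).neg
  have h := hTW m
  rw [nsmul_eq_mul, mul_one] at h
  rwa [proj_apply]

/-- **All orders are `≤ w i − ζ`**: the order-`m` datum of `A ∈ graded ⊓ zKernel Z` on `ε_i` vanishes as soon as `w i < m + ζ` (LF-MODEL-eng1-g45 §6.3 SET-UP;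
instrument, NOT a resolution theorem). [cite: AbramovichTemkinWlodarczyk2024, §5.1 (p. 1575); Lang2002, Ch. IV §1] -/
theorem proj_eq_zero_of_lt (hw : ∀ i, 0 ≤ w i) (hZ : ∀ z ∈ Z, ζ ≤ w z)
    (hAg : IsGradedHom w (1 : ℚ) (A : (MvPolynomial ι k)[X] →+* (MvPolynomial ι k)[X])) (hAk : A ∈ zKernel Z) {m : ℕ} {i : ι}
    (hi : w i < m + ζ) : proj m A i = 0 :=
  eq_zero_of_mem_span_of_lt hw hZ (proj_mem_span hAk m i) (isWeightedHomogeneous_proj hAg m i) (by linarith)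

/-- A datum on a fixed slot vanishes (bookkeeping). [cite: Lang2002, Ch. IV §1] -/
theorem proj_eq_zero_of_fix {m : ℕ} {i : ι} (h : A (C (MvPolynomial.X i)) = C (MvPolynomial.X i)) : proj m A i = 0 := by
  rw [proj_apply, h, sub_self, coeff_zero]

/-- **The variables of a datum**: a variable of the order-`m` datum (`m ≥ 1`) of `A ∈ graded ⊓ zKernel Z` on a slot of weight `≤ p + 1` is LIGHT (`< p`) and
LIGHTER than the slot — "heavy slots move by light polynomials, light slots by lighter light polynomials" (LF-MODEL-eng1-g45 §6.3 SET-UP; `Z` light of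
weight `≥ ζ > 0`; instrument, NOT a resolution theorem). [cite: AbramovichTemkinWlodarczyk2024, §5.1 (p. 1575); Lang2002, Ch. II §1] -/
theorem vars_proj {p : ℕ} (hw : ∀ i, 0 ≤ w i) (hZ : ∀ z ∈ Z, ζ ≤ w z) (hζ : 0 < ζ) (hZp : ∀ z ∈ Z, w z < p)
    (hAg : IsGradedHom w (1 : ℚ) (A : (MvPolynomial ι k)[X] →+* (MvPolynomial ι k)[X])) (hAk : A ∈ zKernel Z) {m : ℕ} (hm : 1 ≤ m)
    {i : ι} (hi : w i ≤ (p : ℚ) + 1) {j : ι} (hj : j ∈ (proj m A i).vars) : w j < p ∧ w j < w i := by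
  have hle : w j ≤ w i - m := le_of_mem_vars hw (isWeightedHomogeneous_proj hAg m i) hj
  have hm' : (1 : ℚ) ≤ m := by exact_mod_cast hm
  refine ⟨?_, by linarith⟩
  by_cases hjZ : j ∈ Z
  · exact hZp j hjZ
  · have h := le_sub_of_mem_vars_of_not_mem hw hZ (proj_mem_span hAk m i) (isWeightedHomogeneous_proj hAg m i) hj hjZ
    linarith

/-- **A slot of weight `< n + ζ` is fixed by `A ∈ graded ⊓ zKernel Z ∩ 𝔄_n`**: orders `< n` vanish by the level, orders `≥ n` by the weight (LF-MODEL-eng1-g45 §6.3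
SET-UP "there are no pure terms"; instrument, NOT a resolution theorem). [cite: Lang2002, Ch. IV §1; AbramovichTemkinWlodarczyk2024, §5.1 (p. 1575)] -/
theorem apply_CX_eq_of_mem_level (hw : ∀ i, 0 ≤ w i) (hZ : ∀ z ∈ Z, ζ ≤ w z)
    (hAg : IsGradedHom w (1 : ℚ) (A : (MvPolynomial ι k)[X] →+* (MvPolynomial ι k)[X])) (hAk : A ∈ zKernel Z) {n : ℕ}
    (hl : A ∈ level (X : (MvPolynomial ι k)[X]) n) {i : ι} (hi : w i < n + ζ) : A (C (MvPolynomial.X i)) = C (MvPolynomial.X i) := by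
  rw [← sub_eq_zero]
  refine Polynomial.ext fun m => ?_
  rw [coeff_zero, ← proj_apply]
  rcases lt_or_ge m n with hmn | hmn
  · exact LevelProjection.proj_eq_zero_of_lt hmn hl i
  · have hnm : (n : ℚ) ≤ m := by exact_mod_cast hmn
    exact proj_eq_zero_of_lt hw hZ hAg hAk (by linarith)

/-- **`𝒢` HAS NO PURE TERMS: `𝒢 ∩ 𝔄_n = {id}`** once every slot either weighs `< n + ζ` or is fixed — in the toy model `n = p + 1` (non-`V` slots weigh `≤ p + 1`,
`V` is fixed), i.e. `H_{p+1} = {id}` of LF-MODEL-eng1-g45 §6.3 (instrument for engine 1's `W(f)` toy model, NOT a resolution theorem).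
[cite: Lang2002, Ch. IV §1; AbramovichTemkinWlodarczyk2024, §5.1 (p. 1575), Thm. 5.3.1 (2)–(3) (p. 1578)] -/
theorem eq_one_of_mem_level (hw : ∀ i, 0 ≤ w i) (hZ : ∀ z ∈ Z, ζ ≤ w z) (hAg : A ∈ graded w (1 : ℚ)) (hAb : A ∈ baseFixing)
    (hAk : A ∈ zKernel Z) {n : ℕ} (hl : A ∈ level (X : (MvPolynomial ι k)[X]) n)
    (hV : ∀ i, w i < n + ζ ∨ A (C (MvPolynomial.X i)) = C (MvPolynomial.X i)) : A = 1 :=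
  eq_one_of_apply_CX hAb fun i => (hV i).elim (fun hi => apply_CX_eq_of_mem_level hw hZ hAg.1 hAk hl hi) id

/-- … packaged for a subgroup `H ≤ 𝒢`: `H ∩ 𝔄_n = {1}` (the hypothesis `hbot` of `EigenLift.exists_deepest_level` / `eigen_climb`, with `n = p + 1`; bookkeeping).
[cite: Lang2002, Ch. I §3, Ch. IV §1] -/
theorem levelIn_eq_bot (hw : ∀ i, 0 ≤ w i) (hZ : ∀ z ∈ Z, ζ ≤ w z) {H : Subgroup ((MvPolynomial ι k)[X] ≃+* (MvPolynomial ι k)[X])}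
    (hHg : H ≤ graded w (1 : ℚ)) (hHb : H ≤ baseFixing) (hHk : H ≤ zKernel Z) {n : ℕ} {V : Set ι} (hHV : H ≤ fixSlots V)
    (hV : ∀ i, w i < n + ζ ∨ i ∈ V) : levelIn (X : (MvPolynomial ι k)[X]) H n = ⊥ := by
  refine (Subgroup.eq_bot_iff_forall _).mpr fun x hx => ?_
  have h1 : (x : (MvPolynomial ι k)[X] ≃+* (MvPolynomial ι k)[X]) = 1 :=
    eq_one_of_mem_level hw hZ (hHg x.2) (hHb x.2) (hHk x.2) (mem_levelIn.mp hx)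
      fun i => (hV i).imp_right fun hi => hHV x.2 i hi
  exact Subtype.ext h1

/-! ### `π_r(A)` read as a derivation -/

/-- **`𝔇 := π_r(A)` read as a derivation of `k[ε]`**: `𝔇(ε_i) :=` the order-`r` datum of `A` on `ε_i` (construction; LF-MODEL-eng1-g45 §6.2/§6.3 "`𝔇 := π_r(X′)` read as a
derivation"; instrument, NOT a resolution theorem). [cite: Matsumura1987, §25; AbramovichTemkinWlodarczyk2024, §5.1 (p. 1575)] -/
noncomputable def projDer (r : ℕ) (A : (MvPolynomial ι k)[X] ≃+* (MvPolynomial ι k)[X]) :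
    Derivation k (MvPolynomial ι k) (MvPolynomial ι k) :=
  MvPolynomial.mkDerivation k (proj r A)

/-- `𝔇(ε_i) = π_r(A)_i` (bookkeeping). [cite: Matsumura1987, §25] -/
@[simp] theorem projDer_X (r : ℕ) (A : (MvPolynomial ι k)[X] ≃+* (MvPolynomial ι k)[X]) (i : ι) :
    projDer r A (MvPolynomial.X i) = proj r A i :=
  MvPolynomial.mkDerivation_X _ _ _

/-- (tf1) `𝔇 = π_r(A)` is triangular of degree `−r` (bookkeeping). [cite: AbramovichTemkinWlodarczyk2024, Thm. 5.3.1 (2)–(3) (p. 1578); Matsumura1987, §25] -/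
theorem isWeightedHomogeneous_projDer (hAg : IsGradedHom w (1 : ℚ) (A : (MvPolynomial ι k)[X] →+* (MvPolynomial ι k)[X])) (r : ℕ) (i : ι) :
    MvPolynomial.IsWeightedHomogeneous w (projDer r A (MvPolynomial.X i)) (w i - r) := by
  rw [projDer_X]
  exact isWeightedHomogeneous_proj hAg r i

/-- (tf1) the data of `𝔇 = π_r(A)` lie in `(ε_Z)` (bookkeeping). [cite: Lang2002, Ch. II §1; Matsumura1987, §25] -/
theorem projDer_X_mem_span (hAk : A ∈ zKernel Z) (r : ℕ) (i : ι) :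
    projDer r A (MvPolynomial.X i) ∈ (Ideal.span (MvPolynomial.X '' Z) : Ideal (MvPolynomial ι k)) := by
  rw [projDer_X]
  exact proj_mem_span hAk r i

/-- (tf1) `𝔇 = π_r(A)` kills the fixed slots — `ε_Z` and `ε_V` (bookkeeping). [cite: Matsumura1987, §25] -/
theorem projDer_X_of_fix (r : ℕ) {i : ι} (h : A (C (MvPolynomial.X i)) = C (MvPolynomial.X i)) : projDer r A (MvPolynomial.X i) = 0 := by
  rw [projDer_X, proj_eq_zero_of_fix h]

/-- (tf1) `𝔇 = π_r(A)` kills `ε_Z` for `A ∈ zKernel Z` (bookkeeping). [cite: Matsumura1987, §25] -/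
theorem projDer_X_of_mem (hAk : A ∈ zKernel Z) (r : ℕ) {z : ι} (hz : z ∈ Z) : projDer r A (MvPolynomial.X z) = 0 :=
  projDer_X_of_fix r (hAk.1 z hz)

/-- (tf1) the variables of `𝔇(ε_i)`, `𝔇 = π_r(A)`, `r ≥ 1`, are light and lighter than `ε_i` — on slots of weight `≤ p + 1`; `V` is fixed (LF-MODEL-eng1-g45 §6.3 SET-UP;
instrument, NOT a resolution theorem). [cite: AbramovichTemkinWlodarczyk2024, §5.1 (p. 1575); Matsumura1987, §25] -/
theorem vars_projDer {p : ℕ} (hw : ∀ i, 0 ≤ w i) (hZ : ∀ z ∈ Z, ζ ≤ w z) (hζ : 0 < ζ) (hZp : ∀ z ∈ Z, w z < p)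
    (hAg : IsGradedHom w (1 : ℚ) (A : (MvPolynomial ι k)[X] →+* (MvPolynomial ι k)[X])) (hAk : A ∈ zKernel Z)
    (hV : ∀ i, (p : ℚ) + 1 < w i → A (C (MvPolynomial.X i)) = C (MvPolynomial.X i)) {r : ℕ} (hr : 1 ≤ r) (i : ι) :
    ∀ j ∈ (projDer r A (MvPolynomial.X i)).vars, w j < p ∧ w j < w i := by
  intro j hj
  rw [projDer_X] at hj
  rcases le_or_gt (w i) ((p : ℚ) + 1) with hi | hi
  · exact vars_proj hw hZ hζ hZp hAg hAk hr hi hj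
  · rw [proj_eq_zero_of_fix (hV i hi), MvPolynomial.vars_0] at hj
    exact absurd hj (Finset.notMem_empty j)

/-- (tf1) `𝔇 = π_r(A)` vanishes on `ε_V` when `A` fixes `V` (bookkeeping). [cite: Matsumura1987, §25] -/
theorem projDer_X_of_V {p : ℕ} (hV : ∀ i, (p : ℚ) + 1 < w i → A (C (MvPolynomial.X i)) = C (MvPolynomial.X i)) (r : ℕ) (i : ι)
    (hi : (p : ℚ) + 1 < w i) : projDer r A (MvPolynomial.X i) = 0 :=
  projDer_X_of_fix r (hV i hi)

end SetUp

/-! ## CASE `r = p` OF THEOREM B -/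

section CaseTop

variable {w : ι → ℚ} {Z : Set ι} {ζ : ℚ} {A : (MvPolynomial ι k)[X] ≃+* (MvPolynomial ι k)[X]} {p : ℕ}

/-- **The shape at level `p`**: `A ∈ graded ⊓ zKernel Z ∩ 𝔄_p` moves a slot of weight `< p + 1 + ζ` by `σ^p · π_p(A)_i` exactly — lower orders vanish by the level, higher
ones by the weight (LF-MODEL-eng1-g45 §6.3 CASE `r = p`: "`X′(ε_x) = ε_x + σ^p·q_x`"; instrument, NOT a resolution theorem). [cite: Lang2002, Ch. IV §1; AbramovichTemkinWlodarczyk2024, §5.1 (p. 1575)] -/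
theorem apply_CX_eq_of_mem_level_p (hw : ∀ i, 0 ≤ w i) (hZ : ∀ z ∈ Z, ζ ≤ w z)
    (hAg : IsGradedHom w (1 : ℚ) (A : (MvPolynomial ι k)[X] →+* (MvPolynomial ι k)[X])) (hAk : A ∈ zKernel Z)
    (hl : A ∈ level (X : (MvPolynomial ι k)[X]) p) {i : ι} (hi : w i < (p : ℚ) + 1 + ζ) :
    A (C (MvPolynomial.X i)) = C (MvPolynomial.X i) + C (proj p A i) * X ^ p := by
  rw [← sub_eq_iff_eq_add']
  refine Polynomial.ext fun m => ?_
  rw [← proj_apply, coeff_C_mul_X_pow]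
  rcases lt_trichotomy m p with hmp | rfl | hmp
  · rw [if_neg hmp.ne, LevelProjection.proj_eq_zero_of_lt hmp hl]
  · rw [if_pos rfl]
  · rw [if_neg hmp.ne']
    have hpm : (p : ℚ) + 1 ≤ m := by exact_mod_cast hmp
    exact proj_eq_zero_of_lt hw hZ hAg hAk (by linarith)

/-- **CASE `r = p` OF THEOREM B**: a non-trivial graded `Z`-infinitesimal `k[σ]`-isotropy of `g` in `𝔄_p` fixing `V` yields the tailed light flow `(0, q)`,
`q_i := π_p(A)_i`, of unit `1` on `(N, g)` (`T := σ`: light forms in `(ε_Z)` of weight `w i − p` on the heavy slots, `g(ε + σ^p q) = g`) — contradicting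
`NoTailedLightFlow p u w g` (THEOREM 𝔉′).  LF-MODEL-eng1-g45 §6.3 CASE `r = p`; instrument for engine 1's `W(f)` toy model, NOT a resolution theorem.
[cite: Matsumura1987, §27 (pp. 207–209); Lang2002, Ch. IV §1; AbramovichTemkinWlodarczyk2024, §5.1 (p. 1575), Thm. 5.3.1 (2)–(3) (p. 1578)] -/
theorem false_of_mem_level_p {u : ℕ → k} {g : MvPolynomial ι k} (hu : ∀ n < p, (Nat.factorial n : k) * u n = 1) (hp : 2 ≤ p)
    (hw : ∀ i, 0 ≤ w i) (hZ : ∀ z ∈ Z, ζ ≤ w z) (hζ : 0 < ζ)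
    (hAg : A ∈ graded w (1 : ℚ)) (hAb : A ∈ baseFixing) (hAk : A ∈ zKernel Z)
    (hV : ∀ i, (p : ℚ) + 1 < w i → A (C (MvPolynomial.X i)) = C (MvPolynomial.X i))
    (hl : A ∈ level (X : (MvPolynomial ι k)[X]) p) (h1 : A ≠ 1) (hg : A (C g) = C g)
    (hN : TailedLightFlow.NoTailedLightFlow p u w g) : False := by
  have hp0 : 0 < p := by omega
  set q : ι → MvPolynomial ι k := fun i => proj p A i with hq
  have hqV : ∀ i, (p : ℚ) + 1 < w i → q i = 0 := fun i hi => proj_eq_zero_of_fix (hV i hi)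
  have hslot : ∀ i, A (C (MvPolynomial.X i)) = C (MvPolynomial.X i) + C (q i) * X ^ p := fun i => by
    rcases le_or_gt (w i) ((p : ℚ) + 1) with hi | hi
    · exact apply_CX_eq_of_mem_level_p hw hZ hAg.1 hAk hl (by linarith)
    · rw [hqV i hi, map_zero, zero_mul, add_zero, hV i hi]
  have hsig : ∀ i, sigmaExp (0 : Derivation k (MvPolynomial ι k) (MvPolynomial ι k)) p u (MvPolynomial.X i) = C (MvPolynomial.X i) :=
    fun i => by
      have h := TailedLightFlow.substC_X_eq_C (0 : Derivation k (MvPolynomial ι k) (MvPolynomial ι k)) p u 0 hu hp0 (i := i) rfl rfl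
      rwa [TailedLightFlow.substC_X, Pi.zero_apply, map_zero, zero_mul, add_zero] at h
  have hcomp : (A : (MvPolynomial ι k)[X] →+* (MvPolynomial ι k)[X]).comp C =
      (TailedLightFlow.substC (0 : Derivation k (MvPolynomial ι k) (MvPolynomial ι k)) p u q : MvPolynomial ι k →+* (MvPolynomial ι k)[X]) :=
    MvPolynomial.ringHom_ext
      (fun c => by rw [RingHom.comp_apply, RingEquiv.coe_toRingHom, hAb.2 c, AlgHom.coe_toRingHom, TailedLightFlow.substC_C])
      (fun i => by rw [RingHom.comp_apply, RingEquiv.coe_toRingHom, hslot i, AlgHom.coe_toRingHom, TailedLightFlow.substC_X, hsig i])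
  have hfix : TailedLightFlow.substC (0 : Derivation k (MvPolynomial ι k) (MvPolynomial ι k)) p u q g = C g := by
    have h := RingHom.congr_fun hcomp g
    rw [RingHom.comp_apply, RingEquiv.coe_toRingHom, hg, AlgHom.coe_toRingHom] at h
    exact h.symm
  have hne : ∃ i, q i ≠ 0 := by
    by_contra hall
    push Not at hall
    exact h1 (eq_one_of_apply_CX hAb fun i => by rw [hslot i, hall i, map_zero, zero_mul, add_zero])
  refine hN 1 0 q
    { pos := one_pos
      wt_D := fun i => by rw [Derivation.zero_apply]; exact MvPolynomial.isWeightedHomogeneous_zero k w _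
      vars_D := fun i j hj => by rw [Derivation.zero_apply, MvPolynomial.vars_0] at hj; exact absurd hj (Finset.notMem_empty j)
      D_X_eq_zero := fun _ _ => Derivation.zero_apply _
      wt_q := fun i => by
        have h := isWeightedHomogeneous_proj hAg.1 p i
        rwa [nsmul_eq_mul, mul_one]
      vars_q := fun i j hj => by
        rcases le_or_gt (w i) ((p : ℚ) + 1) with hi | hi
        · have hle : w j ≤ w i - p := le_of_mem_vars hw (isWeightedHomogeneous_proj hAg.1 p i) hj
          have hp2 : (2 : ℚ) ≤ p := by exact_mod_cast hp
          linarith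
        · rw [hqV i hi, MvPolynomial.vars_0] at hj
          exact absurd hj (Finset.notMem_empty j)
      q_eq_zero := fun i hi => hi.elim
        (fun hi => eq_zero_of_mem_span_of_lt hw hZ (proj_mem_span hAk p i) (isWeightedHomogeneous_proj hAg.1 p i) (by linarith))
        (fun hi => hqV i hi)
      fix := hfix
      ne_zero := Or.inr hne }

end CaseTop

/-! ## The terminal bridges of the cases `2 ≤ r ≤ p − 1` and `r = 1` -/

section Bridges

variable {w : ι → ℚ} {p : ℕ} {u : ℕ → k} {g : MvPolynomial ι k}

/-- `σ ↦ σ^r` on `R[σ]` is `Polynomial.expand` (plumbing: `Polynomial.aeval (X ^ r)` and `expand R r` agree definitionally; links `TruncatedFlow.flowC D p u (X ^ r)` to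
`expand`). [cite: Lang2002, Ch. IV §1] -/
theorem aeval_X_pow_eq_expand {R : Type*} [CommRing R] (r : ℕ) (f : R[X]) : Polynomial.aeval (X ^ r : R[X]) f = Polynomial.expand R r f := rfl

/-- With no tail `Φ(T) = Σ_{b<p} u_b T^b 𝔇^b` (bookkeeping). [cite: Matsumura1987, §27 (pp. 207–209)] -/
theorem substC_zero_eq_sigmaExp (D : Derivation k (MvPolynomial ι k) (MvPolynomial ι k)) (p : ℕ) (u : ℕ → k) :
    TailedLightFlow.substC D p u 0 = sigmaExp D p u :=
  MvPolynomial.algHom_ext fun i => by rw [TailedLightFlow.substC_X, Pi.zero_apply, map_zero, zero_mul, add_zero]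

/-- **BRIDGE (case `2 ≤ r ≤ p − 1` of THEOREM B)**: if `g(Φ_𝔇(σ^r)ε) = g` in `k[ε][σ]` — i.e. `expand r (Σ_{b<p} u_b σ^b 𝔇^b g) = g` — for a non-zero triangular
`𝔇` of degree `−r`, `r ≥ 1`, with light data lighter than the slot and `𝔇 = 0` on `ε_V`, then `(𝔇, 0)` is a tailed light flow of unit `r` on `(N, g)` with the FREE
variable `T := σ^r` (`k[T] → k[σ]` injective: `Polynomial.expand_injective`) — contradicting `NoTailedLightFlow p u w g` (LF-MODEL-eng1-g45 §6.3 CASE `2 ≤ r ≤ p − 1`, last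
step; instrument for engine 1's `W(f)` toy model, NOT a resolution theorem). [cite: Matsumura1987, §27 (pp. 207–209); Lang2002, Ch. IV §1; AbramovichTemkinWlodarczyk2024, Thm. 5.3.1 (2)–(3) (p. 1578)] -/
theorem false_of_expand_sigmaExp (hN : TailedLightFlow.NoTailedLightFlow p u w g) {r : ℕ} (hr : 0 < r)
    {D : Derivation k (MvPolynomial ι k) (MvPolynomial ι k)}
    (wt_D : ∀ i, MvPolynomial.IsWeightedHomogeneous w (D (MvPolynomial.X i)) (w i - r))
    (vars_D : ∀ i, ∀ j ∈ (D (MvPolynomial.X i)).vars, w j < p ∧ w j < w i)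
    (D_V : ∀ i, (p : ℚ) + 1 < w i → D (MvPolynomial.X i) = 0) (hD0 : ∃ i, D (MvPolynomial.X i) ≠ 0)
    (hfix : Polynomial.expand (MvPolynomial ι k) r (sigmaExp D p u g) = C g) : False := by
  have hfix' : sigmaExp D p u g = C g := Polynomial.expand_injective hr (by rw [hfix, expand_C])
  refine hN r D 0
    { pos := by exact_mod_cast hr
      wt_D := wt_D
      vars_D := vars_D
      D_X_eq_zero := D_V
      wt_q := fun i => by rw [Pi.zero_apply]; exact MvPolynomial.isWeightedHomogeneous_zero k w _
      vars_q := fun i j hj => by rw [Pi.zero_apply, MvPolynomial.vars_0] at hj; exact absurd hj (Finset.notMem_empty j)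
      q_eq_zero := fun _ _ => rfl
      fix := by rw [substC_zero_eq_sigmaExp, hfix']
      ne_zero := Or.inl hD0 }

/-- **BRIDGE (case `r = 1` of THEOREM B)**: if the `k[σ]`-automorphism `A` agrees on `k[ε]` with the tailed substitution `Φ(σ)` of a pair `(𝔇, q) ≠ 0` of the shapes (tf1)/(tf3)
(`A ε_i = Σ_{b<p} u_b σ^b 𝔇^b(ε_i) + σ^p q_i`) and fixes `g`, then `(𝔇, q)` is a tailed light flow of unit `θ` on `(N, g)` (`T := σ`) — contradicting `NoTailedLightFlow p u w g`
(LF-MODEL-eng1-g45 §6.3 CASE `r = 1`, last step "rename `σ =: T`"; instrument for engine 1's `W(f)` toy model, NOT a resolution theorem). [cite: Matsumura1987, §27 (pp. 207–209); Lang2002, Ch. IV §1] -/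
theorem false_of_apply_eq_substC (hN : TailedLightFlow.NoTailedLightFlow p u w g) {θ : ℚ} (hθ : 0 < θ)
    {D : Derivation k (MvPolynomial ι k) (MvPolynomial ι k)} {q : ι → MvPolynomial ι k}
    (wt_D : ∀ i, MvPolynomial.IsWeightedHomogeneous w (D (MvPolynomial.X i)) (w i - θ))
    (vars_D : ∀ i, ∀ j ∈ (D (MvPolynomial.X i)).vars, w j < p ∧ w j < w i)
    (D_V : ∀ i, (p : ℚ) + 1 < w i → D (MvPolynomial.X i) = 0)
    (wt_q : ∀ i, MvPolynomial.IsWeightedHomogeneous w (q i) (w i - p • θ)) (vars_q : ∀ i, ∀ j ∈ (q i).vars, w j < p)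
    (q_eq_zero : ∀ i, w i < p ∨ (p : ℚ) + 1 < w i → q i = 0)
    (hne : (∃ i, D (MvPolynomial.X i) ≠ 0) ∨ ∃ i, q i ≠ 0)
    {A : (MvPolynomial ι k)[X] ≃+* (MvPolynomial ι k)[X]} (hAc : ∀ c : k, A (C (MvPolynomial.C c)) = C (MvPolynomial.C c))
    (hA : ∀ i, A (C (MvPolynomial.X i)) = TailedLightFlow.substC D p u q (MvPolynomial.X i)) (hg : A (C g) = C g) : False := by
  have hcomp : (A : (MvPolynomial ι k)[X] →+* (MvPolynomial ι k)[X]).comp C =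
      (TailedLightFlow.substC D p u q : MvPolynomial ι k →+* (MvPolynomial ι k)[X]) :=
    MvPolynomial.ringHom_ext
      (fun c => by rw [RingHom.comp_apply, RingEquiv.coe_toRingHom, hAc c, AlgHom.coe_toRingHom, TailedLightFlow.substC_C])
      (fun i => by rw [RingHom.comp_apply, RingEquiv.coe_toRingHom, hA i, AlgHom.coe_toRingHom])
  have hfix : TailedLightFlow.substC D p u q g = C g := by
    have h := RingHom.congr_fun hcomp g
    rw [RingHom.comp_apply, RingEquiv.coe_toRingHom, hg, AlgHom.coe_toRingHom] at h
    exact h.symm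
  exact hN θ D q
    { pos := hθ, wt_D := wt_D, vars_D := vars_D, D_X_eq_zero := D_V, wt_q := wt_q, vars_q := vars_q, q_eq_zero := q_eq_zero,
      fix := hfix, ne_zero := hne }

end Bridges

end Literature.AlgebraicGeometry.Resolution.WeightedBlowup.ZKernel
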